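import Summits.BirchSwinnertonDyer.BirchSwinnertonDyer.Theorems.PrintCf2SplitBadTwoLocalControlKernelExact
import Summits.BirchSwinnertonDyer.BirchSwinnertonDyer.Theorems.GoldfeldAllTwistsTwoConverseTwinAdditiveTamagawaProduct
import Literature.NumberTheory.QuadraticFields.ImaginaryQuadraticPrescribedSplittingInert
import Literature.NumberTheory.ComplexMultiplication.WeilNumberPrimeInvariants
import HarnessLib

/-!
# Crux `PrintCf2.SplitBadTwoRankOneOfFacts` (stmt-BirchSwinnertonDyer-20368), road α v10.3 (stub S3c `stub_restrictedControl_two`) —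
# brick B16-TAM: the odd places of the cokernel bound ARE S3c's Tamagawa term — `#{w : 2 ∉ w, 7d ∈ w} + 2 = v₂ ∏_ℓ c_ℓ(W/ℚ)` (`7 ∤ d`)

Cell `bsd-print-cf2`, width seat `bsd-line-cf2-p1-w3` g8 (prover-bsd-line-cf2-p1-w3-g8-0). `--supports stmt-BirchSwinnertonDyer-20368`
(helper, Theses-free). HONEST FRAMING: nothing here closes the crux or a registered stub; BSD is not proved by any of this; no summit
statement is proved by this seat. No definition, no named fact, no `sorry`.

WHY. S3c's right-hand side carries `padicValNat 2 W.tamagawaProduct`; the control side carries the cokernel bound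
`[𝔖^Γ : res 𝔖_{v̄}(K, W*)] ≤ ∏_{w ∈ T} #LK_w · #LK_{v̄}` over `T = {w : 2 ∉ w, 7d ∈ w}` (LEAD p658316/p658763, -w3 g7 p660499:
`v₂ ≤ #T + 2`), whose odd factors are now EXACT (`#LK_w = 2` iff `w` does not split completely in `K*_∞`, this seat's p662395). This
file is the TRANSLATION `#T ↔ v₂ Tam(W)`: Greenberg's «`∏_{w ∣ ℓ} #LK_w = c_ℓ^{(p)}`» (LNM 1716 §3, Lemma 3.3 and p. 88) for the summand,
in the form S3c consumes.
WHAT.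
* §1 (any number field `K`) counting finite places above a finite set of rational primes: `eq_of_natCast_mem_of_natCast_mem` (two
  distinct rational primes never lie in one prime of `𝓞 K`), `card_filter_natCast_mem_eq_ncard_primesOver` (the places `w ∋ ℓ` are
  Mathlib's `(ℓ).primesOver (𝓞 K)`, via `CMNumbers.mem_primesOverSet_iff`), **`card_eq_sum_ncard_primesOver`**.
* §2 (quadratic `K` with `d_K = −7`, i.e. `ℚ(√−7)`): `ncard_primesOver_eq_one_of_dvd_discr` (a ramified odd prime has ONE prime above
  it — Dedekind–Kummer, the tree's `Quadratic.ncard_primesOver_eq_card_toFinset`), **`ncard_primesOver_eq_of_discr_eq_neg_seven`**: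
  for an odd prime `ℓ ≠ 7`, `#{w ∣ ℓ} = if (ℓ/7) = −1 then 1 else 2` (decomposition law `Quadratic.ncard_primesOver_eq_two_iff_jacobiSym` /
  `…_eq_one_of_jacobiSym_eq_neg_one` + reciprocity `(−7/ℓ) = (ℓ/7)`, bsd-goldfeld c301's `jacobiSym_neg_seven_eq_of_odd`).
* §3 THE FRAME (`C • W = cm7^{(d)}`, `d` squarefree, `d ≢ 1 (4)`, `7 ∤ d`, `K` imaginary quadratic with `θ² = −7`):
  `card_places_seven_mul_eq` (`#T = 1 + Σ_{ℓ ∣ d odd} (1 | 2)`), `padicValNat_two_tamagawaProduct_of_frame` (`v₂ Tam(W) = 3 + Σ_{ℓ ∣ d odd} (1 | 2)`,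
  from c301's uniform law `GoldfeldGoodTwists.tamagawaProduct_eq_of_smul_eq_cm7_quadraticTwist`: `Tam = 8 · ∏_{ℓ ∣ d odd} (2 | 4)`), hence
  **`card_places_add_two_eq_padicValNat_tamagawaProduct`: `#T + 2 = v₂ Tam(W)`** (the `2` is `v₂ c₂ = v₂ 4`).
* §4 CONSEQUENCES for the control of `𝔖_{v̄}(K*_∞, W*)` on every such frame: **`padicValNat_two_relIndex_control_of_frame_le_tamagawaProduct`**
  (`v₂ [𝔖^Γ : res 𝔖_{v̄}(K, W*)] ≤ v₂ Tam(W)`, p660499 re-read) and, granted (C1) «no `w ∈ T` splits completely in `K*_∞`» (displayed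
  hypothesis, B15 memo), **`sum_padicValNat_localKer_top_of_frame_add_two_eq`**: `Σ_{w ∈ T} v₂ #LK_w + 2 = v₂ Tam(W)` EXACTLY, and
  `prod_natCard_localKer_top_of_frame_eq_two_pow`.
NOT covered: members with `7 ∣ d` (c301's law assumes `7 ∤ d`; the identity is expected there too — `c₇ ∈ {2}` for all of `49a` — but is
not proved here); the dyadic factor `#LK_{v̄}` (B15) and the surjectivity defect (LEAD's XL piece) are untouched.
presearch: Greenberg LNM 1716 §3 Lemma 3.3 / p. 88 («c_v^{(p)} = |E(F_v)_p|» at additive v), Agboola 2007 §6 («one unit per prime above ℓ ∣ d»),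
Silverman ATAEC IV.9 Table 4.1 — held (corpus book:coates1999-arithmetic-theory-elliptic-curves p. 88); tree: c301's Tamagawa law + the
`QuadraticFields` decomposition law are reused BY NAME, nothing re-derived. No fact filed. beyond-print theorem: no.

References: [GreenbergLNM1716] §3 Lemma 3.3, p. 88; [Agboola2007] §3 Prop. 3.2, §6; [Marcus2018] Ch. 3 Thm. 25; [Silverman1994] IV.9.4, Table 4.1.
-/

noncomputable section

open scoped Classical

set_option linter.dupNamespace false
set_option autoImplicit false

open NumberField IsDedekindDomain Field WeierstrassCurve
open Literature.NumberTheory.EllipticCurves Literature.NumberTheory.EllipticCurves.GreenbergSelmer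
open Literature.NumberTheory.EllipticCurves.Agboola2007
open Literature.NumberTheory.EllipticCurves.IwasawaDual
open Literature.NumberTheory.GaloisRepresentations
open IsDedekindDomain.HeightOneSpectrum

universe u

namespace Summit.BirchSwinnertonDyer.BirchSwinnertonDyer.Theorems.PrintCf2.TamagawaPlaces

/-! ## §1. Counting the finite places above a finite set of rational primes -/

section Places

variable (K : Type) [Field K] [NumberField K]

omit [NumberField K] in
/-- Two distinct rational primes never lie in the same prime of `𝓞 K` (Bézout: `1 = aℓ + bℓ'` would lie in it). [folklore] -/
theorem eq_of_natCast_mem_of_natCast_mem {ℓ ℓ' : ℕ} (hℓ : ℓ.Prime) (hℓ' : ℓ'.Prime) (w : HeightOneSpectrum (𝓞 K))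
    (h : ((ℓ : ℕ) : 𝓞 K) ∈ w.asIdeal) (h' : ((ℓ' : ℕ) : 𝓞 K) ∈ w.asIdeal) : ℓ = ℓ' := by
  by_contra hne
  have hcop : Nat.gcd ℓ ℓ' = 1 := (Nat.coprime_primes hℓ hℓ').mpr hne
  have hbez : ((ℓ : ℤ) * Nat.gcdA ℓ ℓ' + (ℓ' : ℤ) * Nat.gcdB ℓ ℓ') = 1 := by
    rw [← Nat.gcd_eq_gcd_ab, hcop, Nat.cast_one]
  have h1 : (1 : 𝓞 K) ∈ w.asIdeal := by
    have e : ((ℓ : ℕ) : 𝓞 K) * ((Nat.gcdA ℓ ℓ' : ℤ) : 𝓞 K) + ((ℓ' : ℕ) : 𝓞 K) * ((Nat.gcdB ℓ ℓ' : ℤ) : 𝓞 K) = 1 := by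
      have := congrArg (fun z : ℤ ↦ (z : 𝓞 K)) hbez
      push_cast at this
      exact this
    rw [← e]
    exact w.asIdeal.add_mem (w.asIdeal.mul_mem_right _ h) (w.asIdeal.mul_mem_right _ h')
  exact w.isPrime.ne_top ((Ideal.eq_top_iff_one _).mpr h1)

/-- **The places `w ∋ ℓ` are the primes of `𝓞 K` over `ℓ`**: for a prime `ℓ` and a finite set `T` of places containing every `w` with `ℓ ∈ w`,
`#{w ∈ T : ℓ ∈ w} = #((ℓ).primesOver (𝓞 K))` (Mathlib's `Ideal.primesOver`; membership `CMNumbers.mem_primesOverSet_iff`).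
[cite: NeukirchANT1999, Ch. I (8.2)] -/
theorem card_filter_natCast_mem_eq_ncard_primesOver {ℓ : ℕ} (hℓ : ℓ.Prime) (T : Finset (HeightOneSpectrum (𝓞 K)))
    (hT : ∀ w : HeightOneSpectrum (𝓞 K), ((ℓ : ℕ) : 𝓞 K) ∈ w.asIdeal → w ∈ T) :
    (T.filter fun w ↦ ((ℓ : ℕ) : 𝓞 K) ∈ w.asIdeal).card = ((Ideal.span {(ℓ : ℤ)}).primesOver (𝓞 K)).ncard := by
  haveI : Fact ℓ.Prime := ⟨hℓ⟩
  have hbot : (Ideal.span {(ℓ : ℤ)} : Ideal ℤ) ≠ ⊥ := by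
    rw [Ne, Ideal.span_singleton_eq_bot]
    exact_mod_cast hℓ.ne_zero
  rw [← Nat.card_coe_set_eq, ← Fintype.card_coe, ← Nat.card_eq_fintype_card]
  refine Nat.card_congr
    { toFun := fun w ↦ ⟨w.1.asIdeal, by
        haveI := w.1.isPrime
        exact (Literature.NumberTheory.ComplexMultiplication.CMNumbers.mem_primesOverSet_iff ℓ w.1.asIdeal).mpr
          (Finset.mem_filter.mp w.2).2⟩
      invFun := fun P ↦ ⟨⟨P.1, P.2.1, Ideal.ne_bot_of_mem_primesOver hbot P.2⟩, by
        haveI := P.2.1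
        have hmem : ((ℓ : ℕ) : 𝓞 K) ∈ P.1 :=
          (Literature.NumberTheory.ComplexMultiplication.CMNumbers.mem_primesOverSet_iff ℓ P.1).mp P.2
        exact Finset.mem_filter.mpr ⟨hT _ hmem, hmem⟩⟩
      left_inv := fun w ↦ Subtype.ext (HeightOneSpectrum.ext rfl)
      right_inv := fun P ↦ Subtype.ext rfl }

/-- **`#T = Σ_{ℓ ∈ S} #((ℓ).primesOver (𝓞 K))`** when `T` is the set of places containing some prime of the finite set `S` of rational primes
(disjoint union over `ℓ ∈ S` by `eq_of_natCast_mem_of_natCast_mem`). [cite: NeukirchANT1999, Ch. I (8.2)] -/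
theorem card_eq_sum_ncard_primesOver (S : Finset ℕ) (hS : ∀ ℓ ∈ S, ℓ.Prime) (T : Finset (HeightOneSpectrum (𝓞 K)))
    (hT : ∀ w : HeightOneSpectrum (𝓞 K), w ∈ T ↔ ∃ ℓ ∈ S, ((ℓ : ℕ) : 𝓞 K) ∈ w.asIdeal) :
    T.card = ∑ ℓ ∈ S, ((Ideal.span {(ℓ : ℤ)}).primesOver (𝓞 K)).ncard := by
  have hTU : T = S.biUnion (fun ℓ ↦ T.filter fun w ↦ ((ℓ : ℕ) : 𝓞 K) ∈ w.asIdeal) := by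
    ext w
    simp only [Finset.mem_biUnion, Finset.mem_filter]
    constructor
    · intro hw
      obtain ⟨ℓ, hℓS, hℓw⟩ := (hT w).mp hw
      exact ⟨ℓ, hℓS, hw, hℓw⟩
    · rintro ⟨ℓ, -, hw, -⟩
      exact hw
  rw [hTU, Finset.card_biUnion]
  · refine Finset.sum_congr rfl fun ℓ hℓ ↦ ?_
    exact card_filter_natCast_mem_eq_ncard_primesOver K (hS ℓ hℓ) T (fun w hw ↦ (hT w).mpr ⟨ℓ, hℓ, hw⟩)
  · intro ℓ hℓ ℓ' hℓ' hne
    exact Finset.disjoint_filter.mpr fun w _ h h' ↦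
      hne (eq_of_natCast_mem_of_natCast_mem K (hS ℓ (Finset.mem_coe.mp hℓ)) (hS ℓ' (Finset.mem_coe.mp hℓ')) w h h')

end Places

/-! ## §2. The decomposition law in `ℚ(√−7)`: `#{w ∣ 7} = 1`, `#{w ∣ ℓ} = if (ℓ/7) = −1 then 1 else 2` -/

section Quadratic

open Literature.NumberTheory.QuadraticFields.Quadratic Polynomial

variable (K : Type) [Field K] [NumberField K]

/-- **A ramified odd prime has exactly ONE prime above it** in a quadratic field: if `p ∣ d_K` (`p` odd) then `#((p).primesOver (𝓞 K)) = 1`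
(Dedekind–Kummer for `𝓞 K = ℤ[ω]`, `minpoly ω = X² − tX − m` with `t² + 4m = d_K ≡ 0 (mod p)` a square).
[cite: Marcus2018, Ch. 3 Thm. 25 (decomposition law, ramified case)] -/
theorem ncard_primesOver_eq_one_of_dvd_discr (h2 : Module.finrank ℚ K = 2) {p : ℕ} [hp : Fact p.Prime] (hp2 : p ≠ 2)
    (hdvd : (p : ℤ) ∣ NumberField.discr K) :
    ((Ideal.span {(p : ℤ)}).primesOver (𝓞 K)).ncard = 1 := by
  obtain ⟨b, hb⟩ := exists_basis_zero_eq_one h2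
  haveI : NeZero (2 : ZMod p) := ⟨two_ne_zero_zmod hp2⟩
  rw [ncard_primesOver_eq_card_toFinset b hb]
  have hdisc := discr_eq_sq_add_four_mul b hb
  have h0 : (((b.repr (b 1 * b 1) 1 : ℤ) : ZMod p)) ^ 2 + 4 * ((b.repr (b 1 * b 1) 0 : ℤ) : ZMod p) = 0 := by
    have h : (((b.repr (b 1 * b 1) 1) ^ 2 + 4 * b.repr (b 1 * b 1) 0 : ℤ) : ZMod p) = 0 := by
      rw [← hdisc]
      exact (ZMod.intCast_zmod_eq_zero_iff_dvd _ p).mpr hdvd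
    push_cast at h
    exact h
  exact card_toFinset_normalizedFactors_X_sq_sub_of_eq_zero h0

/-- **The decomposition law in `ℚ(√−7)` at an odd prime `ℓ ≠ 7`**: `#{w ∣ ℓ} = 1` if `(ℓ/7) = −1` (inert) and `= 2` otherwise (split),
for any quadratic `K` with `d_K = −7`; `(−7/ℓ) = (ℓ/7)` by reciprocity (bsd-goldfeld `jacobiSym_neg_seven_eq_of_odd`).
[cite: Marcus2018, Ch. 3 Thm. 25 (decomposition law at odd p)] -/
theorem ncard_primesOver_eq_of_discr_eq_neg_seven (h2 : Module.finrank ℚ K = 2) (hdisc : NumberField.discr K = -7)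
    {ℓ : ℕ} (hℓ : ℓ.Prime) (hℓ2 : ℓ ≠ 2) (hℓ7 : ℓ ≠ 7) :
    ((Ideal.span {(ℓ : ℤ)}).primesOver (𝓞 K)).ncard = if jacobiSym ℓ 7 = -1 then 1 else 2 := by
  have hodd : Odd ℓ := hℓ.odd_of_ne_two hℓ2
  have hrec : jacobiSym (NumberField.discr K) ℓ = jacobiSym ℓ 7 := by
    rw [hdisc]
    exact GoldfeldGoodTwists.jacobiSym_neg_seven_eq_of_odd hodd
  split_ifs with h
  · exact ncard_primesOver_eq_one_of_jacobiSym_eq_neg_one h2 hℓ (hrec.trans h)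
  · have hgcd : (NumberField.discr K).gcd ℓ = 1 := by
      rw [hdisc]
      have h7 : Nat.gcd 7 ℓ = 1 := (Nat.coprime_primes (by norm_num) hℓ).mpr (Ne.symm hℓ7)
      rw [Int.gcd, show (-7 : ℤ).natAbs = 7 by rfl]
      exact_mod_cast h7
    have h1 : jacobiSym (NumberField.discr K) ℓ = 1 := by
      rcases jacobiSym.eq_one_or_neg_one hgcd with h1 | h1
      · exact h1
      · exact absurd (hrec ▸ h1) h
    exact (ncard_primesOver_eq_two_iff_jacobiSym h2 hℓ hℓ2).mpr h1

end Quadratic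

/-! ## §3. The frame: `#{w : 2 ∉ w, 7d ∈ w} + 2 = v₂ Tam(W)` -/

section Frame

open Rat.HeightOneSpectrum
open Summit.BirchSwinnertonDyer.BirchSwinnertonDyer.Theorems.PrintCf2.AdditiveAtSeven
open Summit.BirchSwinnertonDyer.BirchSwinnertonDyer.Theorems.PrintCf2.ReductionTypesOverK
open Summit.BirchSwinnertonDyer.BirchSwinnertonDyer.Theorems.PrintCf2.RestrictedSelmerPair

variable (K : Type) [Field K] [NumberField K]

/-- **`#T = 1 + Σ_{ℓ ∣ d, ℓ odd} (1 | 2)`** for `T = {w : 2 ∉ w, 7d ∈ w}` (`d ≠ 0`, `7 ∤ d`) over a quadratic `K` with `d_K = −7`: the places of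
`T` are exactly the primes above the odd primes of `7d` (§1), one above `7` (ramified) and `1` or `2` above each odd `ℓ ∣ d` by `(ℓ/7)` (§2).
[cite: Marcus2018, Ch. 3 Thm. 25] [cite: Agboola2007, §6] -/
theorem card_places_seven_mul_eq {d : ℤ} (hd0 : d ≠ 0) (h7 : ¬ (7 : ℤ) ∣ d) (hK2 : Module.finrank ℚ K = 2)
    (hdisc : NumberField.discr K = -7) (T : Finset (HeightOneSpectrum (𝓞 K)))
    (hT : ∀ w : HeightOneSpectrum (𝓞 K), w ∈ T ↔ ((2 : ℕ) : 𝓞 K) ∉ w.asIdeal ∧ ((7 * d : ℤ) : 𝓞 K) ∈ w.asIdeal) :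
    T.card = 1 + ∑ ℓ ∈ d.natAbs.primeFactors.erase 2, (if jacobiSym ℓ 7 = -1 then 1 else 2) := by
  set S : Finset ℕ := insert 7 (d.natAbs.primeFactors.erase 2) with hS
  have hSprime : ∀ ℓ ∈ S, ℓ.Prime := by
    intro ℓ hℓ
    rcases Finset.mem_insert.mp hℓ with rfl | hℓ
    · norm_num
    · exact Nat.prime_of_mem_primeFactors (Finset.mem_of_mem_erase hℓ)
  have h7S : (7 : ℕ) ∉ d.natAbs.primeFactors.erase 2 := by
    intro h
    exact h7 (Int.natCast_dvd.mpr (Nat.dvd_of_mem_primeFactors (Finset.mem_of_mem_erase h)))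
  have hmem : ∀ w : HeightOneSpectrum (𝓞 K), w ∈ T ↔ ∃ ℓ ∈ S, ((ℓ : ℕ) : 𝓞 K) ∈ w.asIdeal := by
    intro w
    rw [hT]
    constructor
    · rintro ⟨h2w, h7d⟩
      have e : ((7 * d : ℤ) : 𝓞 K) = ((7 : ℕ) : 𝓞 K) * ((d : ℤ) : 𝓞 K) := by push_cast; ring
      rw [e] at h7d
      rcases w.isPrime.mem_or_mem h7d with h | h
      · exact ⟨7, Finset.mem_insert_self _ _, h⟩
      · refine ⟨natGenerator (w.under (𝓞 ℚ)), Finset.mem_insert_of_mem ?_, natCast_natGenerator_mem K w⟩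
        have hℓp : (natGenerator (w.under (𝓞 ℚ))).Prime := prime_natGenerator _
        have hℓd : ((natGenerator (w.under (𝓞 ℚ)) : ℕ) : ℤ) ∣ d := natGenerator_dvd_of_intCast_mem w h
        have hℓ2 : natGenerator (w.under (𝓞 ℚ)) ≠ 2 := fun h2 ↦ h2w (h2 ▸ natCast_natGenerator_mem K w)
        exact Finset.mem_erase.mpr ⟨hℓ2, Nat.mem_primeFactors.mpr ⟨hℓp, Int.natCast_dvd.mp hℓd, Int.natAbs_ne_zero.mpr hd0⟩⟩
    · rintro ⟨ℓ, hℓS, hℓw⟩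
      have hℓp := hSprime ℓ hℓS
      have hℓ2 : ℓ ≠ 2 := by
        rcases Finset.mem_insert.mp hℓS with rfl | hℓ
        · norm_num
        · exact (Finset.mem_erase.mp hℓ).1
      have hℓdvd : (ℓ : ℤ) ∣ 7 * d := by
        rcases Finset.mem_insert.mp hℓS with rfl | hℓ
        · exact dvd_mul_right _ _
        · exact (Int.natCast_dvd.mpr (Nat.dvd_of_mem_primeFactors (Finset.mem_of_mem_erase hℓ))).mul_left _
      refine ⟨fun h2 ↦ hℓ2 (eq_of_natCast_mem_of_natCast_mem K hℓp Nat.prime_two w hℓw h2), ?_⟩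
      obtain ⟨k, hk⟩ := hℓdvd
      have e : ((7 * d : ℤ) : 𝓞 K) = ((ℓ : ℕ) : 𝓞 K) * ((k : ℤ) : 𝓞 K) := by rw [hk]; push_cast; ring
      rw [e]
      exact w.asIdeal.mul_mem_right _ hℓw
  rw [card_eq_sum_ncard_primesOver K S hSprime T hmem, hS, Finset.sum_insert h7S]
  haveI : Fact (Nat.Prime 7) := ⟨by norm_num⟩
  rw [ncard_primesOver_eq_one_of_dvd_discr K hK2 (p := 7) (by norm_num) (by rw [hdisc]; norm_num)]
  congr 1
  refine Finset.sum_congr rfl fun ℓ hℓ ↦ ?_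
  obtain ⟨hℓ2, hℓpf⟩ := Finset.mem_erase.mp hℓ
  have hℓ7 : ℓ ≠ 7 := fun h ↦ h7S (h ▸ hℓ)
  exact ncard_primesOver_eq_of_discr_eq_neg_seven K hK2 hdisc (Nat.prime_of_mem_primeFactors hℓpf) hℓ2 hℓ7

/-- **`v₂ Tam(W) = 3 + Σ_{ℓ ∣ d, ℓ odd} (1 | 2)`** for every model `W` of `cm7^{(d)}` (`d` squarefree, `d ≢ 1 (mod 4)`, `7 ∤ d`): bsd-goldfeld
c301's uniform law `Tam(W) = 8 · ∏_{ℓ ∣ d odd} (2 if (ℓ/7) = −1 else 4)` read `2`-adically (`c₂ = 4`, `c₇ = 2`, `c_ℓ ∈ {2, 4}`).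
[cite: Silverman1994, IV.9.4 and Table 4.1] -/
theorem padicValNat_two_tamagawaProduct_of_frame {d : ℤ} (hsq : Squarefree d) (hd4 : d % 4 ≠ 1) (h7 : ¬ (7 : ℤ) ∣ d)
    (W : WeierstrassCurve ℚ) [W.IsElliptic] (C : VariableChange ℚ) (hC : C • W = cm7.quadraticTwist (d : ℚ)) :
    padicValNat 2 W.tamagawaProduct = 3 + ∑ ℓ ∈ d.natAbs.primeFactors.erase 2, (if jacobiSym ℓ 7 = -1 then 1 else 2) := by
  rw [GoldfeldGoodTwists.tamagawaProduct_eq_of_smul_eq_cm7_quadraticTwist hsq hd4 h7 W C hC]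
  have hprod : (∏ l ∈ d.natAbs.primeFactors.erase 2, (if jacobiSym l 7 = -1 then 2 else 4 : ℕ)) =
      2 ^ ∑ ℓ ∈ d.natAbs.primeFactors.erase 2, (if jacobiSym ℓ 7 = -1 then 1 else 2) := by
    rw [← Finset.prod_pow_eq_pow_sum]
    refine Finset.prod_congr rfl fun ℓ _ ↦ ?_
    split_ifs <;> norm_num
  rw [hprod, show (8 : ℕ) = 2 ^ 3 by norm_num, ← pow_add, padicValNat.prime_pow]

/-- **`#T + 2 = v₂ Tam(W)`** on every frame with `7 ∤ d`: member `C • W = cm7^{(d)}` (`d` squarefree, `d ≢ 1 (mod 4)`, `7 ∤ d`), `K` imaginary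
quadratic with `θ² = −7` (so `d_K = −7`, `ReductionTypesOverK.discr_eq_neg_seven_of_sq_eq`), `T = {w : 2 ∉ w, 7d ∈ w}` — «one unit per prime
of `K` above `ℓ ∣ 7d`» is `v₂ ∏_ℓ c_ℓ(W/ℚ)` minus `v₂ c₂ = 2`. [cite: Agboola2007, §6] [cite: GreenbergLNM1716, §3 Lemma 3.3 and p. 88] -/
theorem card_places_add_two_eq_padicValNat_tamagawaProduct {d : ℤ} (hsq : Squarefree d) (hd4 : d % 4 ≠ 1) (h7 : ¬ (7 : ℤ) ∣ d)
    (W : WeierstrassCurve ℚ) [W.IsElliptic] (C : VariableChange ℚ) (hC : C • W = cm7.quadraticTwist (d : ℚ))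
    (hK : IsImaginaryQuadratic K) {θ : K} (hθ : θ ^ 2 = -7) (T : Finset (HeightOneSpectrum (𝓞 K)))
    (hT : ∀ w : HeightOneSpectrum (𝓞 K), w ∈ T ↔ ((2 : ℕ) : 𝓞 K) ∉ w.asIdeal ∧ ((7 * d : ℤ) : 𝓞 K) ∈ w.asIdeal) :
    T.card + 2 = padicValNat 2 W.tamagawaProduct := by
  have hd0 : d ≠ 0 := hsq.ne_zero
  rw [padicValNat_two_tamagawaProduct_of_frame hsq hd4 h7 W C hC,
    card_places_seven_mul_eq K hd0 h7 hK.1 (discr_eq_neg_seven_of_sq_eq K hK hθ hd0 W hC) T hT]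
  ring

end Frame

end Summit.BirchSwinnertonDyer.BirchSwinnertonDyer.Theorems.PrintCf2.TamagawaPlaces

/-! ## §4. Consequences for the control of `𝔖_{v̄}(K*_∞, W*)` on the frame -/

namespace Summit.BirchSwinnertonDyer.BirchSwinnertonDyer.Theorems.PrintCf2.RestrictedSelmerPair

section Frame

open Summit.BirchSwinnertonDyer.BirchSwinnertonDyer.Theorems.PrintCf2.AdditiveAtSeven
open Summit.BirchSwinnertonDyer.BirchSwinnertonDyer.Theorems.PrintCf2.TamagawaPlaces

variable {K : Type} [Field K] [NumberField K]

/-- **`v₂ [𝔖_{v̄}(K*_∞, W*)^Γ : res 𝔖_{v̄}(K, W*)] ≤ v₂ Tam(W)`** on every S3c frame with `7 ∤ d` — -w3 g7's class bound `≤ #T + 2` (p660499)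
re-read through `#T + 2 = v₂ Tam(W)`: the cokernel of Agboola's control map is bounded by the Tamagawa term of S3c's right-hand side.
Member `C • W = cm7^{(d)}` (`d` squarefree, `d ≢ 1 (mod 4)`, `7 ∤ d`), `K` imaginary quadratic, `v ≠ v̄` over `2`, `π ∈ End_K(E_K)` with
`π² = π − 2`, `r² = r − 2`, `κ'` unramified outside `v̄` with topological generator `γ'`. [cite: Agboola2007, §3 Prop. 3.2, §6]
[cite: GreenbergLNM1716, §3 Lemmas 3.1–3.3] -/
theorem padicValNat_two_relIndex_control_of_frame_le_tamagawaProduct {d : ℤ} (hsq : Squarefree d) (hd4 : d % 4 ≠ 1)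
    (h7 : ¬ (7 : ℤ) ∣ d) (W : WeierstrassCurve ℚ) [W.IsElliptic] (C : VariableChange ℚ) (hC : C • W = cm7.quadraticTwist (d : ℚ))
    (hK : IsImaginaryQuadratic K) {v vbar : HeightOneSpectrum (𝓞 K)} (hv : ((2 : ℕ) : 𝓞 K) ∈ v.asIdeal)
    (hvbar : ((2 : ℕ) : 𝓞 K) ∈ vbar.asIdeal) (hne : vbar ≠ v) (π : (W.baseChange K).endRing)
    (hrel : (π : AddMonoid.End (W.baseChange K).geomPoints) * π = π - 2) {r : ℤ_[2]} (hr : r * r = r - 2)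
    (κ' : ZpExtension K 2) (hκ' : κ'.IsUnramifiedOutside vbar) {γ' : absoluteGaloisGroup K} (hγ' : κ'.IsTopGenerator γ') :
    padicValNat 2 ((((restrictedSelmerBase ↥((W.baseChange K).endEigenPrimaryTorsion 2 π r) 2 vbar).map
        (resOfLe ↥((W.baseChange K).endEigenPrimaryTorsion 2 π r) (le_top : κ'.kerSubgroup ≤ ⊤))).addSubgroupOf
        (restrictedSelmerZp κ' ↥((W.baseChange K).endEigenPrimaryTorsion 2 π r) vbar)).relIndex
      (endInvariants (conjRestricted κ' ↥((W.baseChange K).endEigenPrimaryTorsion 2 π r) vbar γ' - 1))) ≤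
      padicValNat 2 W.tamagawaProduct := by
  have hd0 : d ≠ 0 := hsq.ne_zero
  have hj : W.j = -3375 := j_eq_of_smul_eq_cm7Twist hd0 W C hC
  obtain ⟨θ, hθ⟩ := exists_sq_eq_neg_seven_of_cmEndo_mem_endRing W K hj π hrel
  obtain ⟨T, hT⟩ := exists_finset_seven_mul (K := K) hd0
  have h := padicValNat_two_relIndex_control_of_frame_le hd0 hsq W C hC hK hv hvbar hne π hrel hr κ' hκ' hγ' T hT
  rwa [card_places_add_two_eq_padicValNat_tamagawaProduct K hsq hd4 h7 W C hC hK hθ T hT] at h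

/-- **`∏_{w ∈ T} #LK_w = 2^{#T}`** on the frame, granted (C1) «no `w ∈ T` splits completely in `K*_∞`» (B15 memo; the displayed hypothesis
`hC1`): each odd local kernel has EXACTLY `2` elements (p662395 `natCard_localKer_top_of_frame_eq_two`). `d ≠ 0` squarefree (no `7 ∤ d`
needed here). [cite: GreenbergLNM1716, §3 Lemma 3.3 (p. 88)] [cite: Agboola2007, §3 Prop. 3.2, §6] -/
theorem prod_natCard_localKer_top_of_frame_eq_two_pow {d : ℤ} (hd0 : d ≠ 0) (hsq : Squarefree d)
    (W : WeierstrassCurve ℚ) [W.IsElliptic] (C : VariableChange ℚ) (hC : C • W = cm7.quadraticTwist (d : ℚ))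
    (hK : IsImaginaryQuadratic K) (vbar : HeightOneSpectrum (𝓞 K)) (hvbar : ((2 : ℕ) : 𝓞 K) ∈ vbar.asIdeal)
    (π : (W.baseChange K).endRing) (hrel : (π : AddMonoid.End (W.baseChange K).geomPoints) * π = π - 2)
    {r : ℤ_[2]} (hr : r * r = r - 2) (κ' : ZpExtension K 2) (hκ' : κ'.IsUnramifiedOutside vbar)
    (T : Finset (HeightOneSpectrum (𝓞 K)))
    (hT : ∀ w : HeightOneSpectrum (𝓞 K), w ∈ T ↔ ((2 : ℕ) : 𝓞 K) ∉ w.asIdeal ∧ ((7 * d : ℤ) : 𝓞 K) ∈ w.asIdeal)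
    (hC1 : ∀ w ∈ T, ¬ decomp w ≤ κ'.kerSubgroup) :
    ∏ w ∈ T, Nat.card (resOfLe ↥((W.baseChange K).endEigenPrimaryTorsion 2 π r)
        (inf_le_inf_right (decomp w) (le_top : κ'.kerSubgroup ≤ ⊤))).ker = 2 ^ T.card := by
  rw [← Finset.prod_const]
  refine Finset.prod_congr rfl fun w hw ↦ ?_
  obtain ⟨h2w, h7d⟩ := (hT w).mp hw
  exact (natCard_localKer_top_of_frame_eq_two hd0 hsq W C hC hK vbar hvbar π hrel hr κ' hκ' h2w h7d (hC1 w hw)).2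

/-- **THE ODD LOCAL KERNELS ARE S3c's TAMAGAWA TERM: `Σ_{w ∈ T} v₂ #LK_w + 2 = v₂ Tam(W)` EXACTLY** on every frame with `7 ∤ d`, granted (C1)
«no `w ∈ T` splits completely in `K*_∞`» (displayed hypothesis `hC1`; class field theory for the `ℤ₂`-line of `ℚ(√−7)` unramified outside
`v̄`, NOT proved here). Member `C • W = cm7^{(d)}` (`d` squarefree, `d ≢ 1 (mod 4)`, `7 ∤ d`), `K` imaginary quadratic, `v̄ ∣ 2`,
`π ∈ End_K(E_K)` with `π² = π − 2`, `r² = r − 2`, `κ'` unramified outside `v̄`, `T = {w : 2 ∉ w, 7d ∈ w}`. Greenberg's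
«`∏_{w ∣ ℓ} #ker r_w = c_ℓ^{(p)}`» for the summand, summed over the odd bad primes. [cite: GreenbergLNM1716, §3 Lemma 3.3 and p. 88]
[cite: Agboola2007, §3 Prop. 3.2, §6] -/
theorem sum_padicValNat_localKer_top_of_frame_add_two_eq {d : ℤ} (hsq : Squarefree d) (hd4 : d % 4 ≠ 1) (h7 : ¬ (7 : ℤ) ∣ d)
    (W : WeierstrassCurve ℚ) [W.IsElliptic] (C : VariableChange ℚ) (hC : C • W = cm7.quadraticTwist (d : ℚ))
    (hK : IsImaginaryQuadratic K) (vbar : HeightOneSpectrum (𝓞 K)) (hvbar : ((2 : ℕ) : 𝓞 K) ∈ vbar.asIdeal)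
    (π : (W.baseChange K).endRing) (hrel : (π : AddMonoid.End (W.baseChange K).geomPoints) * π = π - 2)
    {r : ℤ_[2]} (hr : r * r = r - 2) (κ' : ZpExtension K 2) (hκ' : κ'.IsUnramifiedOutside vbar)
    (T : Finset (HeightOneSpectrum (𝓞 K)))
    (hT : ∀ w : HeightOneSpectrum (𝓞 K), w ∈ T ↔ ((2 : ℕ) : 𝓞 K) ∉ w.asIdeal ∧ ((7 * d : ℤ) : 𝓞 K) ∈ w.asIdeal)
    (hC1 : ∀ w ∈ T, ¬ decomp w ≤ κ'.kerSubgroup) :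
    (∑ w ∈ T, padicValNat 2 (Nat.card (resOfLe ↥((W.baseChange K).endEigenPrimaryTorsion 2 π r)
        (inf_le_inf_right (decomp w) (le_top : κ'.kerSubgroup ≤ ⊤))).ker)) + 2 =
      padicValNat 2 W.tamagawaProduct := by
  have hd0 : d ≠ 0 := hsq.ne_zero
  have hj : W.j = -3375 := j_eq_of_smul_eq_cm7Twist hd0 W C hC
  obtain ⟨θ, hθ⟩ := exists_sq_eq_neg_seven_of_cmEndo_mem_endRing W K hj π hrel
  have hsum : (∑ w ∈ T, padicValNat 2 (Nat.card (resOfLe ↥((W.baseChange K).endEigenPrimaryTorsion 2 π r)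
      (inf_le_inf_right (decomp w) (le_top : κ'.kerSubgroup ≤ ⊤))).ker)) = T.card := by
    rw [Finset.card_eq_sum_ones]
    refine Finset.sum_congr rfl fun w hw ↦ ?_
    obtain ⟨h2w, h7d⟩ := (hT w).mp hw
    rw [(natCard_localKer_top_of_frame_eq_two hd0 hsq W C hC hK vbar hvbar π hrel hr κ' hκ' h2w h7d (hC1 w hw)).2]
    simp
  rw [hsum]
  exact card_places_add_two_eq_padicValNat_tamagawaProduct K hsq hd4 h7 W C hC hK hθ T hT

end Frame

end Summit.BirchSwinnertonDyer.BirchSwinnertonDyer.Theorems.PrintCf2.RestrictedSelmerPair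

end
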